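import Summits.BirchSwinnertonDyer.BirchSwinnertonDyer.Theorems.Rank2ObservatoryRank3CensusResidual112
import Summits.BirchSwinnertonDyer.BirchSwinnertonDyer.Theorems.Rank2ObservatoryRank3PSatM31JoinA
import Summits.BirchSwinnertonDyer.BirchSwinnertonDyer.Theorems.Rank2ObservatoryRank3CensusAnalytic
import HarnessLib

/-!
# BirchSwinnertonDyer — rank ≥ 2 observatory: the rank-3 saturation / generators JOINS re-keyed on the RANK (9 375 rows hypothesis-free, 112 under `hup`)

HONEST FRAMING: per-curve certified theorems and census instruments; no claim on BSD in rank ≥ 2.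

THE FINDING this file repairs.  Every landed JOIN of the kernel saturation censuses of the rank-3
table with the rank — `SatCensus.finiteIndex_and_odd_index_of_mem_rows`,
`PSatCensus3/5/7.index_coprime_*_of_mem_rows`, `PSatCensus357.index_coprime_210_of_mem_rows`,
`…listedSpan_eq_top_of_index_le_ten`, and the `generatorsNN` statements of the five generator
registers `PSatCensusS10/M31/M47/K100/S10CPS` and of the union `GeneratorsCensus` — is keyed on
MEMBERSHIP IN `Rank3KernelRankCensusN9365.rows` (`hr : r ∈ rows`, 9 365 rows).  The rank census has
since grown to `Rank3KernelRankCensusN9375` (9 375 rows, `rank_ℤ = 3` with NO hypothesis: the nine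
SSQ class-`H` rows `61504cg1 117242a1 118336bj1 162712a1 254016p1 290222a1 353648c1 447458h1
447458h2` of `TwoDescRank3Census.Part36` and `450754a1` of `Part37`), and the residual register is
`Rank3CensusAudit.residualRows112` (112 rows, upper bound `rank_ℤ ≤ 3` = the named hypothesis
`hup`).  For the `10 + 112 = 122` table rows outside `N9365` the landed join statements are VACUOUS
as typed (their hypothesis `r ∈ N9365.rows` is false), although the saturation censuses themselves
(`2, 3, 5, 7`: `…Saturated_of_mem_rank3Table`) hold for ALL 9 487 rows with no hypothesis.

THE RE-PIN (pure glue of landed theorems BY NAME; no definitions, no data, no `decide` on tables):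
* §1 the joins keyed on the RANK ITSELF — `index_coprime_210_of_rank`: for ANY table row with
  `rank_ℤ E(ℚ) = 3` the listed span `ℤP₁ + ℤP₂ + ℤP₃ + E(ℚ)_tors` has finite index prime to `210`
  (`Rank3Row.finiteIndex_and_odd_index_of_twoSaturated` + the four hypothesis-free saturation
  censuses + `not_dvd_index_listedSpan`); every prime factor of the index is `≥ 11`; GENERATORS
  under the one named numeric hypothesis `index ≤ 10`, and — the form the generator registers use —
  under `index ≤ m` given `p`-saturation for the primes `7 < p ≤ m`
  (`listedSpan_eq_top_of_pSaturated_of_rank`); `generators_of_cover` turns ANY landed register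
  cover `coverNN` (shape `∀ e ∈ L, ∃ r, tbl[e.1]? = some r ∧ ∀ p, p.Prime → 7 < p → p ≤ e.2 → …
  p-saturated`) into the RANK-KEYED generator statement `∀ (h : r.check = true), rank_ℤ = 3 →
  index ≤ m → E(ℚ) = ℤP₁ + ℤP₂ + ℤP₃ + E(ℚ)_tors` (with `monoR` for `GeneratorsCensus.subsume`);
* §2 the census forms: over `Rank3KernelRankCensusN9375.rows` with NO hypothesis (9 375 rows:
  `index_coprime_210_of_mem_rows9375`, `eleven_le_of_prime_dvd_index9375`,
  `listedSpan_eq_top_of_index_le_ten9375`), and over the WHOLE table with `hup` asked ONLY of the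
  112 residual rows (`…112`);
* §3 bookkeeping for the register re-key: `rowsNN_subset_rank3Table` (chunk `NN` ⊆ table, 27
  one-liners) so that `generators_of_cover` applies to the landed chunk covers verbatim.
The HEADLINES at 9 375 (distinct curves, analytic mirror, one-stop row packages) are the companion
file `Rank2ObservatoryRank3CensusCurves9375`.  Counts of record do not change (saturation censuses
9 487/9 487 at `2, 3, 5, 7`; rank `= 3` kernel 9 375, residual 112); what changes is which rows the
JOIN statements actually speak about: 9 365 → 9 375 hypothesis-free, and the 112 residual rows under
`hup` instead of not at all.
Sorry-free; no new axioms; every `decide` of the tree it rests on is already landed.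

References: J. E. Cremona, *Algorithms for Modular Elliptic Curves* (2nd ed. 1997) §3.5, Tables;
S. Siksek, Rocky Mountain J. Math. 25 (1995) §3; J. H. Silverman, *The Arithmetic of Elliptic
Curves* (2nd ed. 2009) Thm. VIII.6.7; J. W. S. Cassels, *Lectures on Elliptic Curves* (1991) §15;
H. Darmon, *Rational Points on Modular Elliptic Curves* (2004) Thm. 3.22.
-/

-- single-conjunct summit: `Summit.BirchSwinnertonDyer.BirchSwinnertonDyer.…` repeats the name by design
set_option linter.dupNamespace false

namespace Summit.BirchSwinnertonDyer.BirchSwinnertonDyer.Rank2Observatory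

open Literature Literature.NumberTheory.EllipticCurves WeierstrassCurve

namespace Rank3Joins112

open Rank3CensusAudit (residualRows112 rank_eq_three_of_mem_rank3Table112 mem_rows9375_iff
  rows9375_nodup residualRows112_subset_rank3Table)
open PSatCensus357 (eleven_le_of_prime_dvd eq_one_of_lt_eleven)
open PSatCensusM31 (eq_one_of_forall_prime_le_not_dvd not_dvd_of_prime_le_seven)

/-! ### §1 The joins keyed on the rank itself -/

/-- **THE JOIN keyed on the RANK: index prime to `210`.** For ANY row of the rank-3 census table
with `rank_ℤ E(ℚ) = 3` the listed span `ℤP₁ + ℤP₂ + ℤP₃ + E(ℚ)_tors` has finite index in `E(ℚ)`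
divisible by none of `2, 3, 5, 7` (the four saturation censuses hold for every table row with no
hypothesis; finiteness and oddness from `2`-saturation + independence + `rank_ℤ = 3`).
[cite: CremonaAlgorithms1997, §3.5] [cite: SilvermanAEC2009, Thm. VIII.6.7] -/
theorem index_coprime_210_of_rank {r : Rank3Row} (hr : r ∈ rank3Table) (h : r.check = true)
    (hrk : r.curve.mordellWeilRank = 3) :
    (AddSubgroup.closure {r.gen₁ h, r.gen₂ h, r.gen₃ h} ⊔ AddCommGroup.torsion _).FiniteIndex ∧
      ¬ 2 ∣ (AddSubgroup.closure {r.gen₁ h, r.gen₂ h, r.gen₃ h} ⊔ AddCommGroup.torsion _).index ∧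
      ¬ 3 ∣ (AddSubgroup.closure {r.gen₁ h, r.gen₂ h, r.gen₃ h} ⊔ AddCommGroup.torsion _).index ∧
      ¬ 5 ∣ (AddSubgroup.closure {r.gen₁ h, r.gen₂ h, r.gen₃ h} ⊔ AddCommGroup.torsion _).index ∧
      ¬ 7 ∣ (AddSubgroup.closure {r.gen₁ h, r.gen₂ h, r.gen₃ h} ⊔ AddCommGroup.torsion _).index :=
  by
  have h₂ := SatCensus.twoSaturated_of_mem_rank3Table hr h
  obtain ⟨hfi, hodd⟩ := r.finiteIndex_and_odd_index_of_twoSaturated h h₂.1 h₂.2 hrk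
  haveI := hfi
  exact ⟨hfi, by have := Nat.odd_iff.mp hodd; omega,
    not_dvd_index_listedSpan Nat.prime_three (PSatCensus3.threeSaturated_of_mem_rank3Table hr h),
    not_dvd_index_listedSpan Nat.prime_five (PSatCensus5.fiveSaturated_of_mem_rank3Table hr h),
    not_dvd_index_listedSpan (by norm_num : Nat.Prime 7)
      (PSatCensus7.sevenSaturated_of_mem_rank3Table hr h)⟩

/-- **Every prime factor of the index is `≥ 11`** for any table row with `rank_ℤ E(ℚ) = 3`.
[cite: CremonaAlgorithms1997, §3.5] -/
theorem eleven_le_of_prime_dvd_index_of_rank {r : Rank3Row} (hr : r ∈ rank3Table)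
    (h : r.check = true) (hrk : r.curve.mordellWeilRank = 3) {p : ℕ} (hp : p.Prime)
    (hd : p ∣ (AddSubgroup.closure {r.gen₁ h, r.gen₂ h, r.gen₃ h} ⊔ AddCommGroup.torsion _).index) :
    11 ≤ p := by
  obtain ⟨_, h2, h3, h5, h7⟩ := index_coprime_210_of_rank hr h hrk
  exact eleven_le_of_prime_dvd h2 h3 h5 h7 hp hd

/-- **GENERATORS under ONE named numeric hypothesis, keyed on the rank**: a table row with
`rank_ℤ E(ℚ) = 3` whose listed span has index `≤ 10` (engine DATA) satisfies
`E(ℚ) = ℤP₁ + ℤP₂ + ℤP₃ + E(ℚ)_tors`. [cite: CremonaAlgorithms1997, §3.5] -/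
theorem listedSpan_eq_top_of_index_le_ten_of_rank {r : Rank3Row} (hr : r ∈ rank3Table)
    (h : r.check = true) (hrk : r.curve.mordellWeilRank = 3)
    (hB : (AddSubgroup.closure {r.gen₁ h, r.gen₂ h, r.gen₃ h} ⊔ AddCommGroup.torsion _).index ≤ 10) :
    AddSubgroup.closure {r.gen₁ h, r.gen₂ h, r.gen₃ h} ⊔ AddCommGroup.torsion _ = ⊤ := by
  obtain ⟨hfi, h2, h3, h5, h7⟩ := index_coprime_210_of_rank hr h hrk
  haveI := hfi
  exact AddSubgroup.index_eq_one.mp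
    (eq_one_of_lt_eleven AddSubgroup.FiniteIndex.index_ne_zero h2 h3 h5 h7 (by omega))

/-- **GENERATORS from `p`-saturation for `7 < p ≤ m`, keyed on the rank** — the shape every
generator register (`PSatCensusS10/M31/M47/K100/S10CPS.generatorsNN`) proves for GRAND rows: a
table row with `rank_ℤ E(ℚ) = 3`, listed span `p`-saturated for every prime `7 < p ≤ m`, and
index `≤ m` (engine DATA) satisfies `E(ℚ) = ℤP₁ + ℤP₂ + ℤP₃ + E(ℚ)_tors` (no prime `≤ m` divides the
index, so it is `1`). [cite: CremonaAlgorithms1997, §3.5] [cite: CremonaPrickettSiksek2006, Thm 1] -/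
theorem listedSpan_eq_top_of_pSaturated_of_rank {r : Rank3Row} (hr : r ∈ rank3Table)
    (h : r.check = true) (hrk : r.curve.mordellWeilRank = 3) {m : ℕ}
    (H : ∀ p, p.Prime → 7 < p → p ≤ m → ∀ a : r.curve.toAffine.Point,
      p • a ∈ AddSubgroup.closure {r.gen₁ h, r.gen₂ h, r.gen₃ h} ⊔ AddCommGroup.torsion _ →
        a ∈ AddSubgroup.closure {r.gen₁ h, r.gen₂ h, r.gen₃ h} ⊔ AddCommGroup.torsion _)
    (hB : (AddSubgroup.closure {r.gen₁ h, r.gen₂ h, r.gen₃ h} ⊔ AddCommGroup.torsion _).index ≤ m) :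
    AddSubgroup.closure {r.gen₁ h, r.gen₂ h, r.gen₃ h} ⊔ AddCommGroup.torsion _ = ⊤ := by
  obtain ⟨hfi, h2, h3, h5, h7⟩ := index_coprime_210_of_rank hr h hrk
  haveI := hfi
  refine AddSubgroup.index_eq_one.mp
    (eq_one_of_forall_prime_le_not_dvd AddSubgroup.FiniteIndex.index_ne_zero hB fun p hp hpB => ?_)
  by_cases h7p : 7 < p
  · exact not_dvd_index_listedSpan hp (H p hp h7p hpB)
  · exact not_dvd_of_prime_le_seven h2 h3 h5 h7 hp h7p

/-- **Register cover ⟹ RANK-KEYED generator statements.** For a chunk `tbl` of the table and any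
landed cover `∀ e ∈ L, ∃ r, tbl[e.1]? = some r ∧ (p-saturated for every prime 7 < p ≤ e.2)`, every
listed `(i, m)` yields: if `rank_ℤ E(ℚ) = 3` and the index of the listed span of `tbl[i]` is `≤ m`,
then `E(ℚ) = ℤP₁ + ℤP₂ + ℤP₃ + E(ℚ)_tors` — with NO membership hypothesis in any rank census.
[cite: CremonaAlgorithms1997, §3.5] -/
theorem generators_of_cover {tbl : List Rank3Row} {L : List (ℕ × ℕ)}
    (htbl : ∀ r ∈ tbl, r ∈ rank3Table)
    (hC : ∀ e ∈ L, ∃ r, tbl[e.1]? = some r ∧ ∀ p, p.Prime → 7 < p → p ≤ e.2 →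
      ∀ h : r.check = true, ∀ a : r.curve.toAffine.Point,
        p • a ∈ AddSubgroup.closure {r.gen₁ h, r.gen₂ h, r.gen₃ h} ⊔ AddCommGroup.torsion _ →
          a ∈ AddSubgroup.closure {r.gen₁ h, r.gen₂ h, r.gen₃ h} ⊔ AddCommGroup.torsion _) :
    ∀ e ∈ L, ∃ r, tbl[e.1]? = some r ∧ ∀ (h : r.check = true), r.curve.mordellWeilRank = 3 →
      (AddSubgroup.closure {r.gen₁ h, r.gen₂ h, r.gen₃ h} ⊔ AddCommGroup.torsion _).index ≤ e.2 →
        AddSubgroup.closure {r.gen₁ h, r.gen₂ h, r.gen₃ h} ⊔ AddCommGroup.torsion _ = ⊤ := by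
  intro e he
  obtain ⟨r, hr', H⟩ := hC e he
  exact ⟨r, hr', fun h hrk hB => listedSpan_eq_top_of_pSaturated_of_rank
    (htbl r (List.mem_of_getElem? hr')) h hrk (fun p hp h7 hpm => H p hp h7 hpm h) hB⟩

/-- The rank-keyed generator statement is antitone in the index bound (for
`GeneratorsCensus.subsume`). [folklore] -/
theorem monoR {tbl : List Rank3Row} : ∀ i m m' : ℕ, m ≤ m' →
    (∃ r, tbl[(i, m').1]? = some r ∧ ∀ (h : r.check = true), r.curve.mordellWeilRank = 3 →
        (AddSubgroup.closure {r.gen₁ h, r.gen₂ h, r.gen₃ h} ⊔ AddCommGroup.torsion _).index ≤ (i, m').2 →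
          AddSubgroup.closure {r.gen₁ h, r.gen₂ h, r.gen₃ h} ⊔ AddCommGroup.torsion _ = ⊤) →
    ∃ r, tbl[(i, m).1]? = some r ∧ ∀ (h : r.check = true), r.curve.mordellWeilRank = 3 →
        (AddSubgroup.closure {r.gen₁ h, r.gen₂ h, r.gen₃ h} ⊔ AddCommGroup.torsion _).index ≤ (i, m).2 →
          AddSubgroup.closure {r.gen₁ h, r.gen₂ h, r.gen₃ h} ⊔ AddCommGroup.torsion _ = ⊤ :=
  fun _ _ _ hm ⟨r, hr, H⟩ => ⟨r, hr, fun h hrk hi => H h hrk (hi.trans hm)⟩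

/-- **The landed GRAND-keyed shape is a COROLLARY of the rank-keyed one** (`N9365 ⊆ N9375`,
`rank_ℤ = 3` a kernel theorem there): nothing already landed is weakened by the re-key. [folklore] -/
theorem generators_grand_of_rank {tbl : List Rank3Row} {e : ℕ × ℕ}
    (H : ∃ r, tbl[e.1]? = some r ∧ ∀ (h : r.check = true), r.curve.mordellWeilRank = 3 →
      (AddSubgroup.closure {r.gen₁ h, r.gen₂ h, r.gen₃ h} ⊔ AddCommGroup.torsion _).index ≤ e.2 →
        AddSubgroup.closure {r.gen₁ h, r.gen₂ h, r.gen₃ h} ⊔ AddCommGroup.torsion _ = ⊤) :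
    ∃ r, tbl[e.1]? = some r ∧ ∀ (hr : r ∈ Rank3KernelRankCensusN9365.rows) (h : r.check = true),
      (AddSubgroup.closure {r.gen₁ h, r.gen₂ h, r.gen₃ h} ⊔ AddCommGroup.torsion _).index ≤ e.2 →
        AddSubgroup.closure {r.gen₁ h, r.gen₂ h, r.gen₃ h} ⊔ AddCommGroup.torsion _ = ⊤ := by
  obtain ⟨r, hr', H⟩ := H
  exact ⟨r, hr', fun hr h hB => H h (Rank3KernelRankCensusN9365.rank_eq_three r hr) hB⟩

/-- **Whole-table shape of a rank-keyed generator statement**: for a table row, `hup : rank_ℤ ≤ 3`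
is asked ONLY if the row is one of the 112 residual rows. [cite: Cassels1991LecturesEllipticCurves, §15]
[cite: CremonaAlgorithms1997, §3.5] -/
theorem generators112_of_rank {tbl : List Rank3Row} (htbl : ∀ r ∈ tbl, r ∈ rank3Table) {e : ℕ × ℕ}
    (H : ∃ r, tbl[e.1]? = some r ∧ ∀ (h : r.check = true), r.curve.mordellWeilRank = 3 →
      (AddSubgroup.closure {r.gen₁ h, r.gen₂ h, r.gen₃ h} ⊔ AddCommGroup.torsion _).index ≤ e.2 →
        AddSubgroup.closure {r.gen₁ h, r.gen₂ h, r.gen₃ h} ⊔ AddCommGroup.torsion _ = ⊤) :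
    ∃ r, tbl[e.1]? = some r ∧ ∀ (h : r.check = true),
      (r ∈ residualRows112 → r.curve.mordellWeilRank ≤ 3) →
      (AddSubgroup.closure {r.gen₁ h, r.gen₂ h, r.gen₃ h} ⊔ AddCommGroup.torsion _).index ≤ e.2 →
        AddSubgroup.closure {r.gen₁ h, r.gen₂ h, r.gen₃ h} ⊔ AddCommGroup.torsion _ = ⊤ := by
  obtain ⟨r, hr', H⟩ := H
  exact ⟨r, hr', fun h hup hB =>
    H h (rank_eq_three_of_mem_rank3Table112 (htbl r (List.mem_of_getElem? hr')) hup) hB⟩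

/-! ### §2 Census forms: N9375 hypothesis-free, whole table with `hup` for the 112 residual rows -/

/-- **THE JOIN over GRAND census N9375 (9 375 rows), NO hypothesis**: `rank_ℤ E(ℚ) = 3` AND the
listed span has finite index prime to `210`. [cite: CremonaAlgorithms1997, §3.5]
[cite: Cassels1991LecturesEllipticCurves, §15] [cite: SilvermanAEC2009, Thm. VIII.6.7] -/
theorem index_coprime_210_of_mem_rows9375 {r : Rank3Row} (hr : r ∈ Rank3KernelRankCensusN9375.rows)
    (h : r.check = true) :
    r.curve.mordellWeilRank = 3 ∧
      (AddSubgroup.closure {r.gen₁ h, r.gen₂ h, r.gen₃ h} ⊔ AddCommGroup.torsion _).FiniteIndex ∧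
      ¬ 2 ∣ (AddSubgroup.closure {r.gen₁ h, r.gen₂ h, r.gen₃ h} ⊔ AddCommGroup.torsion _).index ∧
      ¬ 3 ∣ (AddSubgroup.closure {r.gen₁ h, r.gen₂ h, r.gen₃ h} ⊔ AddCommGroup.torsion _).index ∧
      ¬ 5 ∣ (AddSubgroup.closure {r.gen₁ h, r.gen₂ h, r.gen₃ h} ⊔ AddCommGroup.torsion _).index ∧
      ¬ 7 ∣ (AddSubgroup.closure {r.gen₁ h, r.gen₂ h, r.gen₃ h} ⊔ AddCommGroup.torsion _).index :=
  have hrk := Rank3KernelRankCensusN9375.rank_eq_three r hr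
  ⟨hrk, index_coprime_210_of_rank (Rank3KernelRankCensusN9375.mem_rank3Table r hr) h hrk⟩

/-- **THE JOIN over the WHOLE table (9 487 rows)**, the 2-descent bound `hup : rank_ℤ ≤ 3` being
asked ONLY of the 112 residual rows: `rank_ℤ E(ℚ) = 3` AND finite index prime to `210`.
[cite: CremonaAlgorithms1997, §3.5] [cite: Cassels1991LecturesEllipticCurves, §15] -/
theorem index_coprime_210_of_mem_rank3Table112 {r : Rank3Row} (hr : r ∈ rank3Table)
    (h : r.check = true) (hup : r ∈ residualRows112 → r.curve.mordellWeilRank ≤ 3) :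
    r.curve.mordellWeilRank = 3 ∧
      (AddSubgroup.closure {r.gen₁ h, r.gen₂ h, r.gen₃ h} ⊔ AddCommGroup.torsion _).FiniteIndex ∧
      ¬ 2 ∣ (AddSubgroup.closure {r.gen₁ h, r.gen₂ h, r.gen₃ h} ⊔ AddCommGroup.torsion _).index ∧
      ¬ 3 ∣ (AddSubgroup.closure {r.gen₁ h, r.gen₂ h, r.gen₃ h} ⊔ AddCommGroup.torsion _).index ∧
      ¬ 5 ∣ (AddSubgroup.closure {r.gen₁ h, r.gen₂ h, r.gen₃ h} ⊔ AddCommGroup.torsion _).index ∧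
      ¬ 7 ∣ (AddSubgroup.closure {r.gen₁ h, r.gen₂ h, r.gen₃ h} ⊔ AddCommGroup.torsion _).index :=
  have hrk := rank_eq_three_of_mem_rank3Table112 hr hup
  ⟨hrk, index_coprime_210_of_rank hr h hrk⟩

/-- Every prime factor of the index is `≥ 11`, for every row of GRAND census N9375, NO hypothesis.
[cite: CremonaAlgorithms1997, §3.5] -/
theorem eleven_le_of_prime_dvd_index9375 {r : Rank3Row} (hr : r ∈ Rank3KernelRankCensusN9375.rows)
    (h : r.check = true) {p : ℕ} (hp : p.Prime)
    (hd : p ∣ (AddSubgroup.closure {r.gen₁ h, r.gen₂ h, r.gen₃ h} ⊔ AddCommGroup.torsion _).index) :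
    11 ≤ p :=
  eleven_le_of_prime_dvd_index_of_rank (Rank3KernelRankCensusN9375.mem_rank3Table r hr) h
    (Rank3KernelRankCensusN9375.rank_eq_three r hr) hp hd

/-- Every prime factor of the index is `≥ 11`, for every table row, `hup` for the 112 residual rows
only. [cite: CremonaAlgorithms1997, §3.5] -/
theorem eleven_le_of_prime_dvd_index112 {r : Rank3Row} (hr : r ∈ rank3Table) (h : r.check = true)
    (hup : r ∈ residualRows112 → r.curve.mordellWeilRank ≤ 3) {p : ℕ} (hp : p.Prime)
    (hd : p ∣ (AddSubgroup.closure {r.gen₁ h, r.gen₂ h, r.gen₃ h} ⊔ AddCommGroup.torsion _).index) :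
    11 ≤ p :=
  eleven_le_of_prime_dvd_index_of_rank hr h (rank_eq_three_of_mem_rank3Table112 hr hup) hp hd

/-- GENERATORS under the one named numeric hypothesis `index ≤ 10`, for every row of GRAND census
N9375 (no other hypothesis). [cite: CremonaAlgorithms1997, §3.5] -/
theorem listedSpan_eq_top_of_index_le_ten9375 {r : Rank3Row}
    (hr : r ∈ Rank3KernelRankCensusN9375.rows) (h : r.check = true)
    (hB : (AddSubgroup.closure {r.gen₁ h, r.gen₂ h, r.gen₃ h} ⊔ AddCommGroup.torsion _).index ≤ 10) :
    AddSubgroup.closure {r.gen₁ h, r.gen₂ h, r.gen₃ h} ⊔ AddCommGroup.torsion _ = ⊤ :=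
  listedSpan_eq_top_of_index_le_ten_of_rank (Rank3KernelRankCensusN9375.mem_rank3Table r hr) h
    (Rank3KernelRankCensusN9375.rank_eq_three r hr) hB

/-- GENERATORS under `index ≤ 10` for every table row, `hup` for the 112 residual rows only.
[cite: CremonaAlgorithms1997, §3.5] -/
theorem listedSpan_eq_top_of_index_le_ten112 {r : Rank3Row} (hr : r ∈ rank3Table)
    (h : r.check = true) (hup : r ∈ residualRows112 → r.curve.mordellWeilRank ≤ 3)
    (hB : (AddSubgroup.closure {r.gen₁ h, r.gen₂ h, r.gen₃ h} ⊔ AddCommGroup.torsion _).index ≤ 10) :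
    AddSubgroup.closure {r.gen₁ h, r.gen₂ h, r.gen₃ h} ⊔ AddCommGroup.torsion _ = ⊤ :=
  listedSpan_eq_top_of_index_le_ten_of_rank hr h (rank_eq_three_of_mem_rank3Table112 hr hup) hB

/-- The same with the row-predicate proof supplied by the table (`check_of_mem`), N9375 form.
[cite: CremonaAlgorithms1997, §3.5] -/
theorem index_coprime_210_of_mem_rows9375' {r : Rank3Row} (hr : r ∈ Rank3KernelRankCensusN9375.rows) :
    (AddSubgroup.closure {r.gen₁ (check_of_mem (Rank3KernelRankCensusN9375.mem_rank3Table r hr)),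
        r.gen₂ (check_of_mem (Rank3KernelRankCensusN9375.mem_rank3Table r hr)),
        r.gen₃ (check_of_mem (Rank3KernelRankCensusN9375.mem_rank3Table r hr))} ⊔
        AddCommGroup.torsion _).FiniteIndex ∧
      ∀ p : ℕ, p.Prime → p ∣ (AddSubgroup.closure
        {r.gen₁ (check_of_mem (Rank3KernelRankCensusN9375.mem_rank3Table r hr)),
          r.gen₂ (check_of_mem (Rank3KernelRankCensusN9375.mem_rank3Table r hr)),
          r.gen₃ (check_of_mem (Rank3KernelRankCensusN9375.mem_rank3Table r hr))} ⊔
        AddCommGroup.torsion _).index → 11 ≤ p :=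
  ⟨(index_coprime_210_of_mem_rows9375 hr
      (check_of_mem (Rank3KernelRankCensusN9375.mem_rank3Table r hr))).2.1,
    fun _ hp hd => eleven_le_of_prime_dvd_index9375 hr
      (check_of_mem (Rank3KernelRankCensusN9375.mem_rank3Table r hr)) hp hd⟩

/-! ### §3 Bookkeeping for the register re-key: every chunk is a sublist of the table -/

/-- Membership in a summand of a `27`-fold append. [folklore] -/
private theorem mem_table_of {r : Rank3Row}
    (h : r ∈ rank3Rows01 ∨ r ∈ rank3Rows02 ∨ r ∈ rank3Rows03 ∨ r ∈ rank3Rows04 ∨ r ∈ rank3Rows05 ∨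
      r ∈ rank3Rows06 ∨ r ∈ rank3Rows07 ∨ r ∈ rank3Rows08 ∨ r ∈ rank3Rows09 ∨ r ∈ rank3Rows10 ∨
      r ∈ rank3Rows11 ∨ r ∈ rank3Rows12 ∨ r ∈ rank3Rows13 ∨ r ∈ rank3Rows14 ∨ r ∈ rank3Rows15 ∨
      r ∈ rank3Rows16 ∨ r ∈ rank3Rows17 ∨ r ∈ rank3Rows18 ∨ r ∈ rank3Rows19 ∨ r ∈ rank3Rows20 ∨
      r ∈ rank3Rows21 ∨ r ∈ rank3Rows22 ∨ r ∈ rank3Rows23 ∨ r ∈ rank3Rows24 ∨ r ∈ rank3Rows25 ∨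
      r ∈ rank3Rows26 ∨ r ∈ rank3Rows27) : r ∈ rank3Table := by
  simp only [rank3Table, List.mem_append]
  tauto

/-- Chunk `01` of the table is a sublist of the table. [folklore] -/
theorem rows01_subset_rank3Table : ∀ r ∈ rank3Rows01, r ∈ rank3Table := fun _ h => mem_table_of (by tauto)
/-- Chunk `02` ⊆ table. [folklore] -/
theorem rows02_subset_rank3Table : ∀ r ∈ rank3Rows02, r ∈ rank3Table := fun _ h => mem_table_of (by tauto)
/-- Chunk `03` ⊆ table. [folklore] -/
theorem rows03_subset_rank3Table : ∀ r ∈ rank3Rows03, r ∈ rank3Table := fun _ h => mem_table_of (by tauto)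
/-- Chunk `04` ⊆ table. [folklore] -/
theorem rows04_subset_rank3Table : ∀ r ∈ rank3Rows04, r ∈ rank3Table := fun _ h => mem_table_of (by tauto)
/-- Chunk `05` ⊆ table. [folklore] -/
theorem rows05_subset_rank3Table : ∀ r ∈ rank3Rows05, r ∈ rank3Table := fun _ h => mem_table_of (by tauto)
/-- Chunk `06` ⊆ table. [folklore] -/
theorem rows06_subset_rank3Table : ∀ r ∈ rank3Rows06, r ∈ rank3Table := fun _ h => mem_table_of (by tauto)
/-- Chunk `07` ⊆ table. [folklore] -/
theorem rows07_subset_rank3Table : ∀ r ∈ rank3Rows07, r ∈ rank3Table := fun _ h => mem_table_of (by tauto)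
/-- Chunk `08` ⊆ table. [folklore] -/
theorem rows08_subset_rank3Table : ∀ r ∈ rank3Rows08, r ∈ rank3Table := fun _ h => mem_table_of (by tauto)
/-- Chunk `09` ⊆ table. [folklore] -/
theorem rows09_subset_rank3Table : ∀ r ∈ rank3Rows09, r ∈ rank3Table := fun _ h => mem_table_of (by tauto)
/-- Chunk `10` ⊆ table. [folklore] -/
theorem rows10_subset_rank3Table : ∀ r ∈ rank3Rows10, r ∈ rank3Table := fun _ h => mem_table_of (by tauto)
/-- Chunk `11` ⊆ table. [folklore] -/
theorem rows11_subset_rank3Table : ∀ r ∈ rank3Rows11, r ∈ rank3Table := fun _ h => mem_table_of (by tauto)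
/-- Chunk `12` ⊆ table. [folklore] -/
theorem rows12_subset_rank3Table : ∀ r ∈ rank3Rows12, r ∈ rank3Table := fun _ h => mem_table_of (by tauto)
/-- Chunk `13` ⊆ table. [folklore] -/
theorem rows13_subset_rank3Table : ∀ r ∈ rank3Rows13, r ∈ rank3Table := fun _ h => mem_table_of (by tauto)
/-- Chunk `14` ⊆ table. [folklore] -/
theorem rows14_subset_rank3Table : ∀ r ∈ rank3Rows14, r ∈ rank3Table := fun _ h => mem_table_of (by tauto)
/-- Chunk `15` ⊆ table. [folklore] -/
theorem rows15_subset_rank3Table : ∀ r ∈ rank3Rows15, r ∈ rank3Table := fun _ h => mem_table_of (by tauto)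
/-- Chunk `16` ⊆ table. [folklore] -/
theorem rows16_subset_rank3Table : ∀ r ∈ rank3Rows16, r ∈ rank3Table := fun _ h => mem_table_of (by tauto)
/-- Chunk `17` ⊆ table. [folklore] -/
theorem rows17_subset_rank3Table : ∀ r ∈ rank3Rows17, r ∈ rank3Table := fun _ h => mem_table_of (by tauto)
/-- Chunk `18` ⊆ table. [folklore] -/
theorem rows18_subset_rank3Table : ∀ r ∈ rank3Rows18, r ∈ rank3Table := fun _ h => mem_table_of (by tauto)
/-- Chunk `19` ⊆ table. [folklore] -/
theorem rows19_subset_rank3Table : ∀ r ∈ rank3Rows19, r ∈ rank3Table := fun _ h => mem_table_of (by tauto)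
/-- Chunk `20` ⊆ table. [folklore] -/
theorem rows20_subset_rank3Table : ∀ r ∈ rank3Rows20, r ∈ rank3Table := fun _ h => mem_table_of (by tauto)
/-- Chunk `21` ⊆ table. [folklore] -/
theorem rows21_subset_rank3Table : ∀ r ∈ rank3Rows21, r ∈ rank3Table := fun _ h => mem_table_of (by tauto)
/-- Chunk `22` ⊆ table. [folklore] -/
theorem rows22_subset_rank3Table : ∀ r ∈ rank3Rows22, r ∈ rank3Table := fun _ h => mem_table_of (by tauto)
/-- Chunk `23` ⊆ table. [folklore] -/
theorem rows23_subset_rank3Table : ∀ r ∈ rank3Rows23, r ∈ rank3Table := fun _ h => mem_table_of (by tauto)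
/-- Chunk `24` ⊆ table. [folklore] -/
theorem rows24_subset_rank3Table : ∀ r ∈ rank3Rows24, r ∈ rank3Table := fun _ h => mem_table_of (by tauto)
/-- Chunk `25` ⊆ table. [folklore] -/
theorem rows25_subset_rank3Table : ∀ r ∈ rank3Rows25, r ∈ rank3Table := fun _ h => mem_table_of (by tauto)
/-- Chunk `26` ⊆ table. [folklore] -/
theorem rows26_subset_rank3Table : ∀ r ∈ rank3Rows26, r ∈ rank3Table := fun _ h => mem_table_of (by tauto)
/-- Chunk `27` ⊆ table. [folklore] -/
theorem rows27_subset_rank3Table : ∀ r ∈ rank3Rows27, r ∈ rank3Table := fun _ h => mem_table_of (by tauto)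

end Rank3Joins112

end Summit.BirchSwinnertonDyer.BirchSwinnertonDyer.Rank2Observatory
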